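import Summits.NavierStokesRegularity.NavierStokesRegularity.Theorems.HubbleDynamoNoSelfExcitedDynamoAxisymmetricRung
import Summits.NavierStokesRegularity.NavierStokesRegularity.Theorems.HubbleDynamoNoSelfExcitedDynamoOfTypeIAncientLiouville
import Summits.NavierStokesRegularity.NavierStokesRegularity.Theorems.HubbleDynamoNoSelfExcitedDynamoHardness
import Literature.Analysis.FluidPDE.TypeIAncientMild
import Literature.Analysis.FluidPDE.EulerTimeScaling
import HarnessLib

/-!
# Crux `NoSelfExcitedDynamo` (stmt-NavierStokesRegularity-1934), line `registered`: the axisymmetric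
  rung in the eternal profile-class vocabulary

Theorems file (lands `--supports stmt-NavierStokesRegularity-1934`; registered known-case rung
`rung_axisymmetricProfile`). The crux is reduced (`stub_eternalReduction`) to the non-existence of
nontrivial eternal classical solutions `(W, Q)` of Leray's backward system
`∂ₛW + ½W + ½(y·∇)W + (W·∇)W + ∇Q = ΔW`, `div W = 0` on `ℝ × ℝ³` (`IsBackwardLeraySolutionOn univ 1 W Q`)
in the uniform profile class `(1 + ‖y‖)^{k+1}‖DᵏW(s, y)‖ ≤ K_k`. This file records the KNOWN
axisymmetric case inside that vocabulary: if every slice `W(s, ·)` is axisymmetric, then `W ≡ 0`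
(Koch–Nadirashvili–Seregin–Šverák 2009, Thm 5.3, landed for the crux's physical class as
`stub_axisymmetricRung`).

## Proof

The physical field `u = ofLerayOrbit W`, `u(t, x) = (√(−t))⁻¹ W(−log(−t), x/√(−t))`, is a Type-I
ancient mild field with the `k = 0` profile constant `K₀` (`bridge_isTypeIAncientMild_ofLerayOrbit`),
has the pointwise Type-I bound `‖u(t, x)‖ ≤ K₀/(‖x‖ + √(−t))` (`hasTypeIDecay_iff_lerayOrbit`), and its
slices are axisymmetric (rotations about the axis commute with dilations, `rotZ_smul`). For a lag
`τ > 0` the shifted field `t ↦ u(t − τ)` is a BOUNDED ancient mild solution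
(`IsTypeIAncientMild.isBoundedAncientMildSolution_sub`) with continuous (hence measurable)
axisymmetric slices and the same Type-I bound (`hardness_hasTypeIDecay_translate`), so
`stub_axisymmetricRung` kills it a.e. on every slice, hence everywhere by continuity. Taking
`τ = −t/2` gives `u(t) = 0` for every `t < 0`, and `W = lerayOrbit u = 0`.
-/

noncomputable section

-- the mandated stub namespace repeats `NavierStokesRegularity` (tree precedent for this crux's stubs)
set_option linter.dupNamespace false

namespace Summit.NavierStokesRegularity.NavierStokesRegularity.Theorems.NoSelfExcitedDynamo.Registered

open Set MeasureTheory Filter Topology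
open scoped ContDiff
open Literature.Analysis.FluidPDE

/-- **Slices of the physical field of an axisymmetric profile are axisymmetric**: if every
`W(s, ·)` is axisymmetric then so is every `ofLerayOrbit W (t, ·)` — rotations about the axis commute
with the dilations `x ↦ x/√(−t)` and the amplitude `(√(−t))⁻¹` (`rotZ_smul`). -/
theorem rungAxisym_isAxisymmetric_ofLerayOrbit
    {W : ℝ → EuclideanSpace ℝ (Fin 3) → EuclideanSpace ℝ (Fin 3)} (haxi : ∀ s, IsAxisymmetric (W s))
    (t : ℝ) : IsAxisymmetric (ofLerayOrbit W t) := by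
  intro θ x
  rw [ofLerayOrbit_apply, ofLerayOrbit_apply, ← rotZ_smul θ (Real.sqrt (-t))⁻¹ x, haxi, rotZ_smul]

/-- **The physical field of an axisymmetric eternal profile-class solution vanishes on the past**:
for `u = ofLerayOrbit W` with `(W, Q)` an eternal classical solution of Leray's backward system with
`(1 + ‖y‖)‖W(s, y)‖ ≤ K₀` and axisymmetric slices, `u(t) = 0` for every `t < 0`. For `τ > 0` the
shifted field `t ↦ u(t − τ)` is a bounded ancient mild solution
(`IsTypeIAncientMild.isBoundedAncientMildSolution_sub` after `bridge_isTypeIAncientMild_ofLerayOrbit`)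
with continuous axisymmetric slices and the Type-I bound (`hardness_hasTypeIDecay_translate`), so
KNSS 2009 Thm 5.3 (`stub_axisymmetricRung`) gives a.e.-zero, hence zero, slices; take `τ = −t/2`. -/
theorem rungAxisym_ofLerayOrbit_eq_zero
    {W : ℝ → EuclideanSpace ℝ (Fin 3) → EuclideanSpace ℝ (Fin 3)} {Q : ℝ → EuclideanSpace ℝ (Fin 3) → ℝ}
    (hW : IsBackwardLeraySolutionOn univ 1 W Q) {K₀ : ℝ} (hK₀ : ∀ s y, (1 + ‖y‖) * ‖W s y‖ ≤ K₀)
    (haxi : ∀ s, IsAxisymmetric (W s)) {t : ℝ} (ht : t < 0) : ofLerayOrbit W t = 0 := by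
  set u := ofLerayOrbit W with hu_def
  have hA : IsTypeIAncientMild K₀ u := bridge_isTypeIAncientMild_ofLerayOrbit hW hK₀
  have hdec : HasTypeIDecay K₀ u := by
    refine hasTypeIDecay_iff_lerayOrbit.2 fun s y => ?_
    rw [hu_def, lerayOrbit_ofLerayOrbit_eq]
    exact hK₀ s y
  -- the lag `τ = -t/2 > 0` and the shifted field `v(t') = u(t' - τ)`
  set τ : ℝ := -t / 2 with hτ_def
  have hτ : 0 < τ := by rw [hτ_def]; linarith
  set v : ℝ → EuclideanSpace ℝ (Fin 3) → EuclideanSpace ℝ (Fin 3) := fun t' => u (t' - τ) with hv_def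
  have hmild : IsBoundedAncientMildSolution 1 v := hA.isBoundedAncientMildSolution_sub hτ
  have hmeas : ∀ t' < 0, AEStronglyMeasurable (v t') volume :=
    fun t' ht' => hA.aestronglyMeasurable_slice (by linarith)
  have haxi' : ∀ t' < 0, IsAxisymmetric (v t') :=
    fun t' _ => rungAxisym_isAxisymmetric_ofLerayOrbit haxi (t' - τ)
  have hdec' : HasTypeIDecay K₀ v := by
    have h := hardness_hasTypeIDecay_translate hdec hτ.le
    simpa only [hv_def, sub_eq_add_neg] using h
  -- KNSS Thm 5.3 on the shifted field, at the time `t + τ = t/2 < 0`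
  have hae : v (t + τ) =ᵐ[volume] (0 : EuclideanSpace ℝ (Fin 3) → EuclideanSpace ℝ (Fin 3)) :=
    stub_axisymmetricRung v hmild hmeas haxi' ⟨K₀, hdec'⟩ (t + τ) (by rw [hτ_def]; linarith)
  have hcont : Continuous (v (t + τ)) := hA.continuous_slice (by rw [hτ_def]; linarith)
  have hzero : v (t + τ) = 0 := Measure.eq_of_ae_eq hae hcont continuous_const
  simpa [hv_def] using hzero

/-- **The axisymmetric rung in the eternal profile-class vocabulary** (registered known-case rung
`rung_axisymmetricProfile`; KNSS 2009, Thm 5.3): every eternal classical solution `(W, Q)` of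
Leray's backward system on `ℝ × ℝ³` in the uniform profile class
`(1 + ‖y‖)^{k+1}‖DᵏW(s, y)‖ ≤ K_k` with AXISYMMETRIC slices vanishes identically. Proof: the physical
field `u = ofLerayOrbit W` vanishes on the past (`rungAxisym_ofLerayOrbit_eq_zero`, via the landed
physical-class rung `stub_axisymmetricRung` and the time-shift trick), and `W = lerayOrbit u`. -/
theorem rung_axisymmetricProfile :
    ∀ (W : ℝ → EuclideanSpace ℝ (Fin 3) → EuclideanSpace ℝ (Fin 3)) (Q : ℝ → EuclideanSpace ℝ (Fin 3) → ℝ),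
      IsBackwardLeraySolutionOn univ 1 W Q →
      (∀ k : ℕ, ∃ K : ℝ, ∀ s y, (1 + ‖y‖) ^ (k + 1) * ‖iteratedFDeriv ℝ k (W s) y‖ ≤ K) →
      (∀ s, IsAxisymmetric (W s)) → ∀ s y, W s y = 0 := by
  intro W Q hW hprof haxi s y
  obtain ⟨K₀, hK₀'⟩ := hprof 0
  have hK₀ : ∀ s y, (1 + ‖y‖) * ‖W s y‖ ≤ K₀ := fun s y => by
    have h := hK₀' s y
    rwa [zero_add, pow_one, norm_iteratedFDeriv_zero] at h
  have e : W s y = lerayOrbit (ofLerayOrbit W) s y := by rw [lerayOrbit_ofLerayOrbit_eq]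
  rw [e, lerayOrbit_apply, rungAxisym_ofLerayOrbit_eq_zero hW hK₀ haxi (neg_exp_neg_lt_zero s)]
  simp

end Summit.NavierStokesRegularity.NavierStokesRegularity.Theorems.NoSelfExcitedDynamo.Registered

end
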